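import Mathlib
import Summits.NavierStokesRegularity.NavierStokesRegularity.Theorems.BarrierStepRungThreeCertificateProfileKit
import HarnessLib

/-!
# The profile kit's table constants for the trigger-chain pencil `α₀ + βσ` (route `BarrierStepRungThree`)

Supports items stmt-NavierStokesRegularity-23420 / 23942.  The profile kit
(`CertificateProfile.certificateProfileKit`, `taoLadderRungThree_target_of_boxCertificateKit`) reads the
table only through four coefficient sums on Tao's shift set: per target mode `i`,
`A₀ ≥ ∑_{i₁,i₂} |α_{i₁ i₂ i,(0,0,0)}|` (same shell), `Aₓ ≥ ∑ |α_{·,(1,0,0)}| + ∑ |α_{·,(0,1,0)}|` (shell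
above), `A₁ ≥ ∑ |α_{·,(0,0,1)}|` (pump from the shell below), and the triple sum
`A₁ ≥ ∑_{i₁,i₂,i₃} |α_{i₁ i₂ i₃,(0,0,1)}|` of clause 16.  For the re-instanced line's table — the
trigger-chain PENCIL `α₀ + βσ` of route `HeteroclinicTriggerChain` (explicit three-constant table of
`TriggerChainTable.stub_static`, file `…TriggerChainTableStatic.lean`; ns-bsr3-p3's
`TriggerWindow.inTableClass_pencil` gives `InTableClass (2/β)`) — these sums are computed here:
`A₀ = 1`, `Aₓ = 1`, `A₁ = 1 + β` (`0 ≤ β ≤ 1`; mode `x`: `|−1|`, `β/2 + β/2`, `|1|`; mode `u`: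
`1/2 + 1/2`, `1/2 + 1/2`, `β/2 + β/2`; idle modes `0`).  So the kit's tail conditions for this table
read `hT1 : c (2^{5(kLo-1)/2} ((Q_bG)² + Q_bG √(2E₀)) + 2^{5(kLo-2)/2} (1+β) (Q_bG²)²) ≤ (1-λ) Q_bG` and
`hT2 : c Q_b 2^{5kLo/2} (G 2^{-5/2})² (1 + 1/G + (1+β) G² 2^{-5/2}) ≤ 1 - λ`.

HONEST FRAMING: finite table algebra for a MODEL lattice table (Tao's class E₂(R)); nothing here is a
statement about the Navier–Stokes equations; no summit and no rung is proved by this file.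
-/

noncomputable section

-- the sub-problem namespace repeats the summit name by design (D-0017)
set_option linter.dupNamespace false

namespace Summit.NavierStokesRegularity.NavierStokesRegularity.Theorems

namespace CertificateProfile

open Literature.Analysis.FluidPDE Literature.Analysis.FluidPDE.TaoCascade

/-- **The kit's coefficient sums for the trigger-chain pencil `α₀ + βσ`** (`0 ≤ β ≤ 1`): per target
mode, the same-shell sum is `≤ 1`, the cross-shell sum is `≤ 1`, the pump sum is `≤ 1 + β`, and the
triple pump sum of clause 16 is `≤ 1 + β` — the hypotheses `hA₀`, `hAₓ`, `hA₁i`, `hA₁s` of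
`certificateProfileKit` / `taoLadderRungThree_target_of_boxCertificateKit` with `A₀ = Aₓ = 1`,
`A₁ = 1 + β`. [cite: Tao2016AveragedNS, §4 (4.1)–(4.3) (structure constants on the shift set); the
table is the explicit design of `TriggerChainTable.stub_static`] -/
theorem pencil_kit_sums (τ α₀ τ' σ : Fin 4 → Fin 4 → Fin 4 → ℤ × ℤ × ℤ → ℝ)
    (hτ : τ = fun (a b c : Fin 4) (μ : ℤ × ℤ × ℤ) => if a = 0 ∧ b = 1 ∧ c = 1 then
      (if μ = (0, 0, 0) then (1 : ℝ) / 2 else if μ = (1, 0, 0) then -(1 / 2) else 0) else 0)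
    (hα₀ : α₀ = fun (a b c : Fin 4) (μ : ℤ × ℤ × ℤ) => τ a b c μ - τ c b a (μ.2.2, μ.2.1, μ.1) +
      τ b a c (μ.2.1, μ.1, μ.2.2) - τ c a b (μ.2.2, μ.1, μ.2.1))
    (hτ' : τ' = fun (a b c : Fin 4) (μ : ℤ × ℤ × ℤ) => if a = 0 ∧ b = 1 ∧ c = 1 then
      (if μ = (0, 0, 1) then (1 : ℝ) / 2 else 0) else 0)
    (hσ : σ = fun (a b c : Fin 4) (μ : ℤ × ℤ × ℤ) => τ' a b c μ - τ' c b a (μ.2.2, μ.2.1, μ.1) +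
      τ' b a c (μ.2.1, μ.1, μ.2.2) - τ' c a b (μ.2.2, μ.1, μ.2.1))
    (β : ℝ) (hβ : 0 ≤ β) (hβ1 : β ≤ 1) :
    (∀ i : Fin 4, (∑ i₁ : Fin 4, ∑ i₂ : Fin 4,
        |(fun a b c μ => α₀ a b c μ + β * σ a b c μ) i₁ i₂ i (0, 0, 0)|) ≤ 1) ∧
      (∀ i : Fin 4, (∑ i₁ : Fin 4, ∑ i₂ : Fin 4,
          |(fun a b c μ => α₀ a b c μ + β * σ a b c μ) i₁ i₂ i (1, 0, 0)|) +
        (∑ i₁ : Fin 4, ∑ i₂ : Fin 4,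
          |(fun a b c μ => α₀ a b c μ + β * σ a b c μ) i₁ i₂ i (0, 1, 0)|) ≤ 1) ∧
      (∀ i : Fin 4, (∑ i₁ : Fin 4, ∑ i₂ : Fin 4,
        |(fun a b c μ => α₀ a b c μ + β * σ a b c μ) i₁ i₂ i (0, 0, 1)|) ≤ 1 + β) ∧
      (∑ i₁ : Fin 4, ∑ i₂ : Fin 4, ∑ i₃ : Fin 4,
        |(fun a b c μ => α₀ a b c μ + β * σ a b c μ) i₁ i₂ i₃ (0, 0, 1)|) ≤ 1 + β := by
  subst hα₀ hσ hτ hτ'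
  have hb : |β| = β := abs_of_nonneg hβ
  refine ⟨fun i => ?_, fun i => ?_, fun i => ?_, ?_⟩
  · fin_cases i <;> simp [Fin.sum_univ_four] <;> norm_num
  · fin_cases i
    · simp [Fin.sum_univ_four, hb]; linarith
    · simp [Fin.sum_univ_four]; norm_num
    · simp
    · simp
  · fin_cases i
    · simp [Fin.sum_univ_four]; linarith
    · simp [Fin.sum_univ_four, hb]; linarith
    · simp; linarith
    · simp; linarith
  · simp [Fin.sum_univ_four, hb]; norm_num [hb]; linarith

end CertificateProfile

end Summit.NavierStokesRegularity.NavierStokesRegularity.Theorems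

end
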